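import Mathlib

/-!
# Route `FilamentSkeletonRss` · crux `SkeletonJ1R` (stmt-NavierStokesRegularity-23610) · registered line `streamline_kantorovich_R`
# — brick K-§3e (tools) for stub K `KantorovichClosingL`: PERSISTENCE OF THE UNSTABLE EIGENVECTOR under a small perturbation of an
# orthogonally split operator (bordered coercive inverse + contraction)

Hand `ns-filament-21221-p1` (g18), `--supports stmt-NavierStokesRegularity-23610 --as helper`; pure Mathlib, route-independent.

WHY.  The spectral adapter `…SkeletonJ1RUnstableCurveSpectral.lean` feeds `exists_unstableCurve` from a right eigenvector `ξ`, a left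
eigenvector `ℓ` and a numerical-range bound on `ker ℓ` of `A = Df(p)`.  At the waist zero of the switched field, K knows these data EXACTLY for
the MODEL block `A₀` (slip slope `λ₀` on the tangent `ξ₀`, swirl + contracting strain on the normal plane `ξ₀^⊥`, numerical range `≤ β₀ < λ₀`
there) and knows `‖Df(p) − A₀‖ ≤ ε`.  This file supplies the RIGHT-EIGENVECTOR half of the perturbation step, on a real Hilbert space `E`:
* `exists_inverse_of_inner_ge` (§1): an operator with `⟪T v, v⟫ ≥ c‖v‖²`, `c > 0`, has a two-sided inverse of norm `≤ c⁻¹` (Lax–Milgram,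
  `IsCoercive.continuousLinearEquivOfBilin`);
* `exists_borderedInverse` (§2): if `‖ξ₀‖ = 1`, `A₀ ξ₀ = λ₀ ξ₀`, `ξ₀^⊥` is `A₀`-invariant and `⟪A₀ u, u⟫ ≤ β₀‖u‖²` on `ξ₀^⊥` (`γ = λ₀ − β₀ > 0`),
  the BORDERED operator `T = (λ₀ − A₀) + γ ⟪ξ₀, ·⟫ ξ₀` is `γ`-coercive, so it has an inverse `S`, `‖S v‖ ≤ γ⁻¹‖v‖`, which maps `ξ₀^⊥` into
  `ξ₀^⊥` and inverts `λ₀ − A₀` there;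
* `exists_eigenvector_of_norm_sub_le` (§3): for `‖B‖ ≤ ε ≤ γ/16` there are `w ⊥ ξ₀`, `‖w‖ ≤ 6ε/γ`, and `λ` with `|λ − λ₀| ≤ 2ε` such that
  `(A₀ + B)(ξ₀ + w) = λ (ξ₀ + w)` (contraction `w ↦ S(Π₀ B(ξ₀+w) − ⟪ξ₀, B(ξ₀+w)⟫ w)` on the closed set `{w ⊥ ξ₀, ‖w‖ ≤ 6ε/γ}`).
The companion `…SkeletonJ1RUnstableEigenData.lean` applies §3 to the adjoint to get the left eigenvector and the perturbed numerical-range bound.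

HONEST FRAMING.  Linear-algebra bookkeeping for a sub-brick of the OPEN stub K of the ∃-side of a HYPOTHETICAL filament-type rotating-self-similar
blow-up skeleton (MODEL rung, negative side); stub K, the crux 23610 and its heart stay OPEN; nothing here is a claim about Navier–Stokes regularity
or blow-up.  References: Kato, *Perturbation Theory for Linear Operators* (1966) II §1–§2 (analytic perturbation of a simple eigenvalue);
Lax–Milgram (Mathlib `IsCoercive.continuousLinearEquivOfBilin`).
-/

set_option linter.dupNamespace false -- `NavierStokesRegularity.NavierStokesRegularity` path/namespace repetition is the tree convention

noncomputable section

namespace Summit.NavierStokesRegularity.NavierStokesRegularity.Theorems.SkeletonJ1RUnstableCurve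

open Set Function Filter Metric
open scoped Topology InnerProductSpace

variable {E : Type*} [NormedAddCommGroup E] [InnerProductSpace ℝ E] [CompleteSpace E]

/-! ## §1 Coercive operators are invertible (Lax–Milgram) -/

/-- **A coercive operator is invertible**: if `c‖v‖² ≤ ⟪T v, v⟫` for all `v` (`c > 0`) then there is a bounded `S` with `T (S v) = v`,
`S (T v) = v` and `‖S v‖ ≤ c⁻¹ ‖v‖`. [folklore] -/
theorem exists_inverse_of_inner_ge {T : E →L[ℝ] E} {c : ℝ} (hc : 0 < c) (hT : ∀ v, c * ‖v‖ ^ 2 ≤ ⟪T v, v⟫_ℝ) :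
    ∃ S : E →L[ℝ] E, (∀ v, T (S v) = v) ∧ (∀ v, S (T v) = v) ∧ ∀ v, ‖S v‖ ≤ c⁻¹ * ‖v‖ := by
  set B : E →L[ℝ] E →L[ℝ] ℝ := (innerSL ℝ).comp T with hB
  have hBapply : ∀ v w, B v w = ⟪T v, w⟫_ℝ := fun v w => rfl
  have hcoer : IsCoercive B := ⟨c, hc, fun u => by
    rw [hBapply]; have h := hT u; rw [sq, ← mul_assoc] at h; exact h⟩
  set e : E ≃L[ℝ] E := hcoer.continuousLinearEquivOfBilin with he
  have heT : ∀ v, e v = T v := fun v => by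
    apply ext_inner_right ℝ
    intro w
    rw [IsCoercive.continuousLinearEquivOfBilin_apply, hBapply]
  refine ⟨(e.symm : E →L[ℝ] E), fun v => ?_, fun v => ?_, fun v => ?_⟩
  · have h := e.apply_symm_apply v
    rwa [heT] at h
  · have h := e.symm_apply_apply v
    rwa [heT] at h
  · -- `c ‖S v‖² ≤ ⟪T (S v), S v⟫ = ⟪v, S v⟫ ≤ ‖v‖ ‖S v‖`
    set u : E := (e.symm : E →L[ℝ] E) v with hu
    have hTu : T u = v := by have h := e.apply_symm_apply v; rwa [heT] at h
    have h1 : c * ‖u‖ ^ 2 ≤ ‖v‖ * ‖u‖ := by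
      calc c * ‖u‖ ^ 2 ≤ ⟪T u, u⟫_ℝ := hT u
        _ = ⟪v, u⟫_ℝ := by rw [hTu]
        _ ≤ ‖v‖ * ‖u‖ := real_inner_le_norm _ _
    rcases eq_or_lt_of_le (norm_nonneg u) with h0 | h0
    · rw [← h0]; positivity
    · have h2 : c * ‖u‖ ≤ ‖v‖ := by
        have := h1; rw [sq, ← mul_assoc] at this
        exact le_of_mul_le_mul_right this h0
      calc ‖u‖ = c⁻¹ * (c * ‖u‖) := by field_simp
        _ ≤ c⁻¹ * ‖v‖ := mul_le_mul_of_nonneg_left h2 (inv_nonneg.2 hc.le)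

/-! ## §2 The bordered inverse of `λ₀ − A₀` for an orthogonally split operator -/

/-- **The bordered inverse.**  Let `‖ξ₀‖ = 1`, `A₀ ξ₀ = λ₀ ξ₀`, let `ξ₀^⊥` be `A₀`-invariant (`⟪ξ₀, u⟫ = 0 → ⟪ξ₀, A₀ u⟫ = 0`) and
`⟪A₀ u, u⟫ ≤ β₀ ‖u‖²` on `ξ₀^⊥`, `γ = λ₀ − β₀ > 0`.  Then there is a bounded `S` (the inverse of `T = (λ₀ − A₀) + γ ⟪ξ₀,·⟫ ξ₀`) with
`‖S v‖ ≤ γ⁻¹‖v‖`, mapping `ξ₀^⊥` into itself, and inverting `λ₀ − A₀` on `ξ₀^⊥`: `λ₀ S y − A₀ (S y) = y` for `y ⊥ ξ₀`. [folklore] -/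
theorem exists_borderedInverse {A₀ : E →L[ℝ] E} {ξ₀ : E} {lam₀ β₀ : ℝ} (hξ₀ : ‖ξ₀‖ = 1) (hA₀ξ₀ : A₀ ξ₀ = lam₀ • ξ₀)
    (hinv : ∀ u, ⟪ξ₀, u⟫_ℝ = 0 → ⟪ξ₀, A₀ u⟫_ℝ = 0) (hnum : ∀ u, ⟪ξ₀, u⟫_ℝ = 0 → ⟪A₀ u, u⟫_ℝ ≤ β₀ * ‖u‖ ^ 2) (hγ : β₀ < lam₀) :
    ∃ S : E →L[ℝ] E, (∀ v, ‖S v‖ ≤ (lam₀ - β₀)⁻¹ * ‖v‖) ∧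
      (∀ y, ⟪ξ₀, y⟫_ℝ = 0 → ⟪ξ₀, S y⟫_ℝ = 0 ∧ lam₀ • S y - A₀ (S y) = y) := by
  set γ : ℝ := lam₀ - β₀ with hγdef
  have hγ0 : 0 < γ := by rw [hγdef]; linarith
  -- the bordered operator
  set T : E →L[ℝ] E := (lam₀ • (1 : E →L[ℝ] E) - A₀) + γ • ((innerSL ℝ ξ₀).smulRight ξ₀) with hT
  have hTapply : ∀ v, T v = (lam₀ • v - A₀ v) + γ • (⟪ξ₀, v⟫_ℝ • ξ₀) := fun v => by
    simp [hT, ContinuousLinearMap.smulRight_apply]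
  -- orthogonal decomposition `v = u + c ξ₀`
  have hξξ : ⟪ξ₀, ξ₀⟫_ℝ = 1 := by rw [real_inner_self_eq_norm_sq, hξ₀, one_pow]
  have hdec : ∀ v, ⟪ξ₀, v - ⟪ξ₀, v⟫_ℝ • ξ₀⟫_ℝ = 0 := fun v => by
    rw [inner_sub_right, inner_smul_right, hξξ, mul_one, sub_self]
  have hpyth : ∀ v, ‖v‖ ^ 2 = ‖v - ⟪ξ₀, v⟫_ℝ • ξ₀‖ ^ 2 + ⟪ξ₀, v⟫_ℝ ^ 2 := fun v => by
    set c := ⟪ξ₀, v⟫_ℝ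
    set u := v - c • ξ₀ with hu
    have hv : v = u + c • ξ₀ := by rw [hu]; abel
    have horth : ⟪u, c • ξ₀⟫_ℝ = 0 := by rw [inner_smul_right, real_inner_comm, hdec v, mul_zero]
    have h := norm_add_sq_eq_norm_sq_add_norm_sq_of_inner_eq_zero u (c • ξ₀) horth
    rw [← hv, norm_smul, hξ₀, mul_one, Real.norm_eq_abs, abs_mul_abs_self] at h
    simp only [sq]; exact h
  -- coercivity: `⟪T v, v⟫ ≥ γ ‖v‖²`
  have hcoer : ∀ v, γ * ‖v‖ ^ 2 ≤ ⟪T v, v⟫_ℝ := by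
    intro v
    set c := ⟪ξ₀, v⟫_ℝ with hc
    set u := v - c • ξ₀ with hu
    have hu0 : ⟪ξ₀, u⟫_ℝ = 0 := hdec v
    have hv : v = u + c • ξ₀ := by rw [hu]; abel
    -- `(λ₀ − A₀) v = (λ₀ − A₀) u`
    have e1 : lam₀ • v - A₀ v = lam₀ • u - A₀ u := by
      rw [hv, map_add, map_smul, hA₀ξ₀, smul_add, smul_smul, smul_smul, mul_comm]; abel
    have hX0 : ⟪lam₀ • u - A₀ u, ξ₀⟫_ℝ = 0 := by
      rw [inner_sub_left, inner_smul_left, real_inner_comm ξ₀ u, hu0, real_inner_comm ξ₀ (A₀ u), hinv u hu0]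
      simp
    have e2 : ⟪lam₀ • u - A₀ u, v⟫_ℝ = ⟪lam₀ • u - A₀ u, u⟫_ℝ := by
      rw [hv, inner_add_right, inner_smul_right, hX0, mul_zero, add_zero]
    have e3 : γ * ‖u‖ ^ 2 ≤ ⟪lam₀ • u - A₀ u, u⟫_ℝ := by
      rw [inner_sub_left, inner_smul_left, real_inner_self_eq_norm_sq]
      have h := hnum u hu0
      simp only [RCLike.conj_to_real]
      rw [hγdef]; linarith
    have e4 : ⟪γ • (c • ξ₀), v⟫_ℝ = γ * c ^ 2 := by
      rw [inner_smul_left, inner_smul_left, ← hc]; simp only [conj_trivial]; ring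
    rw [hTapply, inner_add_left, e1, e2, ← hc, e4, hpyth v, ← hu, ← hc, mul_add]
    linarith
  obtain ⟨S, hTS, hST, hSn⟩ := exists_inverse_of_inner_ge hγ0 hcoer
  refine ⟨S, hSn, fun y hy => ?_⟩
  -- `S` maps `ξ₀^⊥` into itself: apply `⟪ξ₀, ·⟫` to `T (S y) = y`
  have hTSy := hTS y
  have hc0 : ⟪ξ₀, S y⟫_ℝ = 0 := by
    have h := congrArg (fun v => ⟪ξ₀, v⟫_ℝ) hTSy
    simp only [hTapply, inner_add_right, inner_sub_right, inner_smul_right, hξξ, mul_one] at h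
    -- `⟪ξ₀, A₀ (S y)⟫ = λ₀ ⟪ξ₀, S y⟫` since `A₀ (S y) = A₀ u + c λ₀ ξ₀`
    set c := ⟪ξ₀, S y⟫_ℝ with hc
    have hAu : ⟪ξ₀, A₀ (S y)⟫_ℝ = lam₀ * c := by
      have hsplit : S y = (S y - c • ξ₀) + c • ξ₀ := by abel
      rw [hsplit, map_add, map_smul, hA₀ξ₀, inner_add_right, hinv _ (hdec (S y)), inner_smul_right, inner_smul_right,
        hξξ]; ring
    rw [hAu, hy] at h
    -- `h : λ₀ c − λ₀ c + γ c = 0`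
    have : γ * c = 0 := by linarith
    exact (mul_eq_zero.1 this).resolve_left hγ0.ne'
  refine ⟨hc0, ?_⟩
  have h := hTSy
  rw [hTapply, hc0, zero_smul, smul_zero, add_zero] at h
  exact h

/-! ## §3 The perturbed right eigenvector -/

/-- **PERSISTENCE OF THE UNSTABLE EIGENVECTOR.**  Let `‖ξ₀‖ = 1`, `A₀ ξ₀ = λ₀ ξ₀`, `ξ₀^⊥` `A₀`-invariant, `⟪A₀ u, u⟫ ≤ β₀‖u‖²` on `ξ₀^⊥`,
`γ = λ₀ − β₀ > 0`, and `‖B‖ ≤ ε` with `16 ε ≤ γ`.  Then `A₀ + B` has an eigenvector `ξ₀ + w` with `w ⊥ ξ₀`, `‖w‖ ≤ 6ε/γ`, for a real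
eigenvalue `λ` with `|λ − λ₀| ≤ 2ε`.  (Contraction `w ↦ S(Π₀ B(ξ₀ + w) − ⟪ξ₀, B(ξ₀ + w)⟫ w)` with the bordered inverse `S` of §2 on the closed set
`{w ⊥ ξ₀, ‖w‖ ≤ 6ε/γ}`; `λ = λ₀ + ⟪ξ₀, B(ξ₀ + w)⟫`.) [cite: Kato1966, II §1.1–§2.2 (perturbation of a simple eigenvalue); here a quantitative `C⁰` version] -/
theorem exists_eigenvector_of_norm_le {A₀ B : E →L[ℝ] E} {ξ₀ : E} {lam₀ β₀ ε : ℝ} (hξ₀ : ‖ξ₀‖ = 1)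
    (hA₀ξ₀ : A₀ ξ₀ = lam₀ • ξ₀) (hinv : ∀ u, ⟪ξ₀, u⟫_ℝ = 0 → ⟪ξ₀, A₀ u⟫_ℝ = 0)
    (hnum : ∀ u, ⟪ξ₀, u⟫_ℝ = 0 → ⟪A₀ u, u⟫_ℝ ≤ β₀ * ‖u‖ ^ 2) (hγ : β₀ < lam₀)
    (hε : 0 ≤ ε) (hB : ‖B‖ ≤ ε) (hεγ : 16 * ε ≤ lam₀ - β₀) :
    ∃ w : E, ∃ lam : ℝ, ⟪ξ₀, w⟫_ℝ = 0 ∧ ‖w‖ ≤ 6 * ε / (lam₀ - β₀) ∧ |lam - lam₀| ≤ 2 * ε ∧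
      (A₀ + B) (ξ₀ + w) = lam • (ξ₀ + w) := by
  set γ : ℝ := lam₀ - β₀ with hγdef
  have hγ0 : 0 < γ := by rw [hγdef]; linarith
  obtain ⟨S, hSn, hS⟩ := exists_borderedInverse hξ₀ hA₀ξ₀ hinv hnum hγ
  set r : ℝ := 6 * ε / γ with hr
  have hr0 : 0 ≤ r := by positivity
  have hr1 : r ≤ 1 := by rw [hr, div_le_one hγ0]; linarith
  have hξξ : ⟪ξ₀, ξ₀⟫_ℝ = 1 := by rw [real_inner_self_eq_norm_sq, hξ₀, one_pow]
  -- the nonlinearity `N w = Π₀ B(ξ₀+w) − ⟪ξ₀, B(ξ₀+w)⟫ w`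
  set N : E → E := fun w => (B (ξ₀ + w) - ⟪ξ₀, B (ξ₀ + w)⟫_ℝ • ξ₀) - ⟪ξ₀, B (ξ₀ + w)⟫_ℝ • w with hN
  have hNorth : ∀ w, ⟪ξ₀, w⟫_ℝ = 0 → ⟪ξ₀, N w⟫_ℝ = 0 := fun w hw => by
    simp only [hN, inner_sub_right, inner_smul_right, hξξ, hw, mul_one, mul_zero, sub_self]
  have hBy : ∀ w, ‖w‖ ≤ r → ‖B (ξ₀ + w)‖ ≤ ε * (1 + r) := fun w hw =>
    calc ‖B (ξ₀ + w)‖ ≤ ‖B‖ * ‖ξ₀ + w‖ := B.le_opNorm _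
      _ ≤ ε * (‖ξ₀‖ + ‖w‖) := mul_le_mul hB (norm_add_le _ _) (norm_nonneg _) hε
      _ ≤ ε * (1 + r) := by rw [hξ₀]; exact mul_le_mul_of_nonneg_left (by linarith) hε
  have hinnerle : ∀ y : E, |⟪ξ₀, y⟫_ℝ| ≤ ‖y‖ := fun y => by
    have h := abs_real_inner_le_norm ξ₀ y; rw [hξ₀, one_mul] at h; exact h
  have hNb : ∀ w, ‖w‖ ≤ r → ‖N w‖ ≤ 6 * ε := by
    intro w hw
    have hy := hBy w hw
    have h1 : ‖B (ξ₀ + w) - ⟪ξ₀, B (ξ₀ + w)⟫_ℝ • ξ₀‖ ≤ 2 * (ε * (1 + r)) := by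
      calc ‖B (ξ₀ + w) - ⟪ξ₀, B (ξ₀ + w)⟫_ℝ • ξ₀‖ ≤ ‖B (ξ₀ + w)‖ + ‖⟪ξ₀, B (ξ₀ + w)⟫_ℝ • ξ₀‖ := norm_sub_le _ _
        _ ≤ ‖B (ξ₀ + w)‖ + ‖B (ξ₀ + w)‖ := by
            rw [norm_smul, hξ₀, mul_one, Real.norm_eq_abs]; exact add_le_add le_rfl (hinnerle _)
        _ ≤ 2 * (ε * (1 + r)) := by linarith
    have h2 : ‖⟪ξ₀, B (ξ₀ + w)⟫_ℝ • w‖ ≤ ε * (1 + r) * r := by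
      rw [norm_smul, Real.norm_eq_abs]
      exact mul_le_mul ((hinnerle _).trans hy) hw (norm_nonneg _) (by positivity)
    have hεr : ε * r ≤ ε := mul_le_of_le_one_right hε hr1
    have hεrr : ε * r * r ≤ ε * r := mul_le_of_le_one_right (mul_nonneg hε hr0) hr1
    calc ‖N w‖ ≤ ‖B (ξ₀ + w) - ⟪ξ₀, B (ξ₀ + w)⟫_ℝ • ξ₀‖ + ‖⟪ξ₀, B (ξ₀ + w)⟫_ℝ • w‖ := norm_sub_le _ _
      _ ≤ 2 * (ε * (1 + r)) + ε * (1 + r) * r := add_le_add h1 h2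
      _ ≤ 6 * ε := by nlinarith [hεr, hεrr]
  have hNL : ∀ w w', ‖w‖ ≤ r → ‖w'‖ ≤ r → ‖N w - N w'‖ ≤ 5 * ε * ‖w - w'‖ := by
    intro w w' hw hw'
    have hd : B (ξ₀ + w) - B (ξ₀ + w') = B (w - w') := by rw [← map_sub]; congr 1; abel
    have hBd : ‖B (w - w')‖ ≤ ε * ‖w - w'‖ := (B.le_opNorm _).trans (mul_le_mul_of_nonneg_right hB (norm_nonneg _))
    have e : N w - N w' = (B (w - w') - ⟪ξ₀, B (w - w')⟫_ℝ • ξ₀)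
        - (⟪ξ₀, B (ξ₀ + w)⟫_ℝ • (w - w') + ⟪ξ₀, B (w - w')⟫_ℝ • w') := by
      simp only [hN, ← hd, inner_sub_right, sub_smul, smul_sub]
      abel
    rw [e]
    have h1 : ‖B (w - w') - ⟪ξ₀, B (w - w')⟫_ℝ • ξ₀‖ ≤ 2 * (ε * ‖w - w'‖) := by
      calc ‖B (w - w') - ⟪ξ₀, B (w - w')⟫_ℝ • ξ₀‖ ≤ ‖B (w - w')‖ + ‖⟪ξ₀, B (w - w')⟫_ℝ • ξ₀‖ := norm_sub_le _ _
        _ ≤ ‖B (w - w')‖ + ‖B (w - w')‖ := by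
            rw [norm_smul, hξ₀, mul_one, Real.norm_eq_abs]; exact add_le_add le_rfl (hinnerle _)
        _ ≤ 2 * (ε * ‖w - w'‖) := by linarith
    have h2 : ‖⟪ξ₀, B (ξ₀ + w)⟫_ℝ • (w - w')‖ ≤ ε * (1 + r) * ‖w - w'‖ := by
      rw [norm_smul, Real.norm_eq_abs]
      exact mul_le_mul_of_nonneg_right ((hinnerle _).trans (hBy w hw)) (norm_nonneg _)
    have h3 : ‖⟪ξ₀, B (w - w')⟫_ℝ • w'‖ ≤ ε * ‖w - w'‖ * r := by
      rw [norm_smul, Real.norm_eq_abs]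
      exact mul_le_mul ((hinnerle _).trans hBd) hw' (norm_nonneg _) (by positivity)
    calc ‖(B (w - w') - ⟪ξ₀, B (w - w')⟫_ℝ • ξ₀) - (⟪ξ₀, B (ξ₀ + w)⟫_ℝ • (w - w') + ⟪ξ₀, B (w - w')⟫_ℝ • w')‖
        ≤ 2 * (ε * ‖w - w'‖) + (ε * (1 + r) * ‖w - w'‖ + ε * ‖w - w'‖ * r) :=
          (norm_sub_le _ _).trans (add_le_add h1 ((norm_add_le _ _).trans (add_le_add h2 h3)))
      _ ≤ 5 * ε * ‖w - w'‖ := by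
          have hdr : ε * ‖w - w'‖ * r ≤ ε * ‖w - w'‖ := mul_le_of_le_one_right (by positivity) hr1
          nlinarith [hdr]
  -- the complete metric space `X = {w ⊥ ξ₀, ‖w‖ ≤ r}` and the contraction `Φ = S ∘ N`
  set X : Set E := {w | ⟪ξ₀, w⟫_ℝ = 0 ∧ ‖w‖ ≤ r} with hXdef
  have hXc : IsClosed X := by
    have h1 : IsClosed {w : E | ⟪ξ₀, w⟫_ℝ = 0} := isClosed_eq (innerSL ℝ ξ₀).continuous continuous_const
    have h2 : IsClosed {w : E | ‖w‖ ≤ r} := isClosed_le continuous_norm continuous_const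
    exact h1.inter h2
  haveI : CompleteSpace X := hXc.completeSpace_coe
  haveI : Nonempty X := ⟨⟨0, by simp [hXdef, hr0]⟩⟩
  have hΦX : ∀ w ∈ X, S (N w) ∈ X := by
    intro w hw
    refine ⟨(hS _ (hNorth w hw.1)).1, ?_⟩
    calc ‖S (N w)‖ ≤ γ⁻¹ * ‖N w‖ := hSn _
      _ ≤ γ⁻¹ * (6 * ε) := mul_le_mul_of_nonneg_left (hNb w hw.2) (inv_nonneg.2 hγ0.le)
      _ = r := by rw [hr]; field_simp
  set Φ : X → X := fun w => ⟨S (N w), hΦX w w.2⟩ with hΦ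
  have hΦc : ContractingWith 2⁻¹ Φ := by
    refine ⟨by norm_num, LipschitzWith.of_dist_le_mul fun w w' => ?_⟩
    rw [Subtype.dist_eq, Subtype.dist_eq, dist_eq_norm, dist_eq_norm]
    show ‖S (N w) - S (N w')‖ ≤ _
    rw [← map_sub]
    calc ‖S (N w - N w')‖ ≤ γ⁻¹ * ‖N w - N w'‖ := hSn _
      _ ≤ γ⁻¹ * (5 * ε * ‖(w : E) - w'‖) := mul_le_mul_of_nonneg_left (hNL _ _ w.2.2 w'.2.2) (inv_nonneg.2 hγ0.le)
      _ ≤ ((2⁻¹ : NNReal) : ℝ) * ‖(w : E) - w'‖ := by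
          have h16 : γ⁻¹ * (5 * ε) ≤ 2⁻¹ := by
            rw [inv_mul_le_iff₀ hγ0]; linarith
          have := mul_le_mul_of_nonneg_right h16 (norm_nonneg ((w : E) - w'))
          simpa [mul_assoc] using this
  set wfix : X := ContractingWith.fixedPoint Φ hΦc with hwfix
  have hfix : S (N wfix) = (wfix : E) := by
    have h := hΦc.fixedPoint_isFixedPt
    have h' := congrArg (fun z : X => (z : E)) h
    exact h'
  set w : E := (wfix : E) with hwdef
  have hw : ⟪ξ₀, w⟫_ℝ = 0 ∧ ‖w‖ ≤ r := wfix.2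
  -- `λ₀ w − A₀ w = N w`
  have hAw : lam₀ • w - A₀ w = N w := by
    have h := (hS _ (hNorth w hw.1)).2
    rwa [hfix] at h
  set y : E := B (ξ₀ + w) with hy
  refine ⟨w, lam₀ + ⟪ξ₀, y⟫_ℝ, hw.1, by rw [hγdef] at hr; exact hr ▸ hw.2, ?_, ?_⟩
  · rw [add_sub_cancel_left]
    exact (hinnerle y).trans ((hBy w hw.2).trans (by nlinarith))
  · -- `(A₀ + B)(ξ₀ + w) = λ₀ ξ₀ + A₀ w + y`, `A₀ w = λ₀ w − N w`, `y = N w + ⟪ξ₀,y⟫ w + ⟪ξ₀,y⟫ ξ₀`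
    have hA₀w : A₀ w = lam₀ • w - N w := by rw [← hAw]; abel
    have hysplit : y = N w + ⟪ξ₀, y⟫_ℝ • w + ⟪ξ₀, y⟫_ℝ • ξ₀ := by simp only [hN, hy]; abel
    have happ : (A₀ + B) (ξ₀ + w) = A₀ (ξ₀ + w) + B (ξ₀ + w) := rfl
    rw [happ, map_add, hA₀ξ₀, hA₀w, ← hy]
    conv_lhs => rw [hysplit]
    rw [add_smul, smul_add, smul_add]
    abel

end Summit.NavierStokesRegularity.NavierStokesRegularity.Theorems.SkeletonJ1RUnstableCurve

end
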